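import Literature.RepresentationTheory.VerySimpleCriterionPerfect
import Literature.RepresentationTheory.PermutationModuleHeartCentralSimple
import Mathlib.LinearAlgebra.Matrix.GeneralLinearGroup.Card
import Mathlib.Algebra.Ring.GeomSum
import HarnessLib

/-!
# The order-bound very-simplicity criterion (Zarhin 2002 [ZarhinCrelle], Corollary 4.4 (i), (iii), (iv); Corollary 4.5; Theorem 4.7 at n = p = 5)

Topic `Literature/RepresentationTheory`, namespace `Literature.RepresentationTheory`; lane `lit-hodgefound`
(Track 2 foundations library), row g12-#3 «(g10-#2)⁺ · (g10-#1)⁺ — [ZarhinCrelle] = Yu. G. Zarhin, *Cyclic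
covers of the projective line, their jacobians and endomorphisms*, J. reine angew. Math. 544 (2002) 91–110
(arXiv:math/0008134; bib `Zarhin2002CyclicCovers`), §4 Corollary 4.4 (iii), (iv): the ORDER-BOUND
very-simplicity criterion».  Theorems only.

p0010: "**Corollary 4.4.** Let `p` be a prime, `V` a vector space over `𝔽_p` of finite dimension `N`. Let
`H ⊂ Aut(V)` be a non-abelian simple group. Suppose that the `H`-module `V` is absolutely simple and `H`
is not isomorphic to a subgroup of `𝐒_N`. Then the `H`-module `V` is very simple if one of the following
conditions holds: (i) `N` is a prime; (ii) `N = 8` or twice a prime. In addition, `H` is not isomorphic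
to `PSL_2(𝔽_p)` and either `H` is not isomorphic to `𝐀_5` or `p` is not congruent to `±1` modulo `5`;
(iii) `#(H) ≥ ((p^{[√N]} − 1)^{[√N]})/(p − 1)`; (iv) `#(H) ≥ (p^N − 1)/(p − 1)`."  p0011, proof: "Let us
split `N` into a product `N = ab` […]. In the case (i) either `a` or `b` is `1` and the target of the
corresponding projective linear group `PGL_1(𝔽_p) = {1}`. […] In order to do the case (iii) notice that
one of the factors say, `a` does not exceed `[√N]`. This implies easily that the order of `GL_a(𝔽_p)`
does not exceed `((p^{[√N]} − 1)^{[√N]})` and therefore the order of `PGL_a(𝔽_p)` does not exceed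
`((p^{[√N]} − 1)^{[√N]})/(p − 1)`. Hence, the order of `H` is strictly greater than the order of
`PGL_a(𝔽_p)` and therefore there are no injective homomorphisms from `H` to `PGL_a(𝔽_p)`. Since `H` is
simple, each homomorphism from `H` is either trivial or injective. This settles the case (iii). The
case (iv) follows readily from the case (iii)."  "**Corollary 4.5.** Suppose `n ≥ 5` is an integer, `B`
is an `n`-element set. Suppose `p = 3`. Then the `Alt(B)`-module `(𝔽_3^B)^{00}` is very simple."

## What is here

* §1 the counting: `#GL_c(𝔽_q) = ∏_{i<c}(q^c − q^i) ≤ (q^c − 1)^c` (Mathlib `Matrix.card_GL_field`;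
  `natCard_GL_le`), STRICTLY for `c ≥ 2` (`natCard_GL_lt` — this strictness is what the printed "Hence,
  the order of `H` is strictly greater" needs: with "`≥`" in (iii) and "does not exceed" for `#PGL_a`
  alone the two orders could coincide); `#PGL_c(𝔽_q) < ((q^c − 1)^c)/(q − 1)` for `c ≥ 2`
  (`natCard_algEquiv_matrix_lt`; `PGL_c(𝔽_q)` is rendered, as in g10-#1/#2, by `Aut_{𝔽_q-alg}(Mat_c(𝔽_q))`
  with `#Aut · (q − 1) = #GL_c`, `natCard_algEquiv_matrix_mul`); monotonicity of the bound in `c ≤ [√N]`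
  (`pow_sub_one_pow_div_mono`) and `((q^{[√N]} − 1)^{[√N]})/(q − 1) ≤ (q^N − 1)/(q − 1)`
  (`pow_sqrt_sub_one_pow_div_le`, "(iv) follows readily from (iii)"); `[√N] = Nat.sqrt N`.
* §2 **Corollary 4.4 (i), (iii), (iv)** over ANY finite field `𝔽_q` (the print: `𝔽_p`), for any simple
  non-abelian `H` acting (faithfulness is not used), "absolutely simple" = irreducible with `End_H(V) = 𝔽`
  (the cluster's rendering, Q1110), "not isomorphic to a subgroup of `𝐒_N`" = no injective `H → 𝐒_N`
  (`not_injective_of_forall_isEmpty_mulEquiv` converts the literal form): `isVerySimple_of_prime_finrank_of_isSimpleGroup`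
  (i), `isVerySimple_of_pow_sqrt_le_card` (iii), `isVerySimple_of_pow_finrank_le_card` (iv), all through
  g10-#2's Theorem 4.3 in min-factor form (`isVerySimple_of_commutator_eq_top'`: `H` perfect —
  `commutator_eq_top_of_isSimpleGroup` —, every `H → 𝐒_N` trivial, every `H → PGL_c(𝔽)` trivial for
  `1 < c ∣ N`, `c² ≤ N`) and "trivial or injective" (`eq_one_or_injective_of_isSimpleGroup`); the verbatim
  `𝔽_p`-forms `zarhin2002_corollary_4_4_i/iii/iv` (`Fintype.card (ZMod p) = p`); **Corollary 4.5**
  verbatim (`zarhin2002_corollary_4_5` = Q1315's `isVerySimple_heart_alternatingGroup_zmod_three`, proved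
  there by a different route).
* §3 **Theorem 4.7** (p0011: "Suppose `n ≥ 5` is a positive integer, `B` is an `n`-element set, `p` is a
  prime. Then the `Alt(B)`-module `(𝔽_p^B)^{00}` is very simple."; proof, last case: "Assume now that
  `n = p`. Then either `n = p = 5` or `n = p = 7`. In both cases `N = dim_{𝔽_p}((𝔽_p^B)^{00}) = n − 2` is a
  prime. Now the very simplicity of `(𝔽_p^B)^{00}` follows from Corollary 4.4 (i).") **at `n = p = 5`**,
  the instance the tree lacked (g11-#3's `isVerySimple_heart_of_prime` covers `n = p = 7`, `13`, …; its
  docstring: "the instance `(n, p) = (5, 5)` is not treated here"): for `#B = 5` and every finite `k`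
  of characteristic `5` the `Alt(B)`-module `(k^B)^{00}` (`N = 3`) is very simple
  (`isVerySimple_heart_alternatingGroup_of_card_eq_five_of_cast_eq_zero`; every `G ↠ ⊇ Alt(B)`:
  `isVerySimple_heart_of_card_eq_five_of_cast_eq_zero`; `k = 𝔽_5`:
  `isVerySimple_heart_alternatingGroup_zmod_of_card_eq_five`) — absolutely simple by Lemma 2.6 at
  `(5, 5)` (g12-#1's `heart_isIrreducible_of_card_eq_five`, `centralizer_heart_eq_bot_of_card_eq_five`),
  `3! < 60 = #𝐀_5`, and the prime case of Theorem 4.3 (g10-#1's `isVerySimple_of_prime_finrank`).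
  With Q1315 (`p ∈ {2, 3}`), g10-#1/g11-#3 (`p ∤ n`, `n − 1` prime; `p ∣ n ≥ 6`, `n − 2` prime; `n = 5`,
  `p ≡ ±2 (mod 5)`) this leaves of Theorem 4.7 exactly the cases the print routes through Corollary 4.4
  (ii) / Corollary 4.6 (`p > 3`: `n = 7 ≠ p`; `n ≥ 8` with neither `n − 1` prime nor (`p ∣ n` and `n − 2`
  prime)); for `n = 5`, `p ≡ ±1 (mod 5)` the printed assertion is corrected in [Zarhin2023Superelliptic,
  Theorem 4.7 (iii), Remark 4.8] (g12-#1's `zarhin2023_theorem_4_7_iii`).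

Not here: Corollary 4.4 (ii) and Corollary 4.6 (Dickson's list of subgroups of `PSL_2(𝔽_p)`; the Schur
multiplier of `𝐀_n` — neither in Mathlib), Theorem 4.7 for `5 ≤ n ≤ 7`, `p > 3` (uses (ii)).

## References
* [Zarhin2002CyclicCovers] Yu. G. Zarhin, *Cyclic covers of the projective line, their jacobians and
  endomorphisms*, J. reine angew. Math. 544 (2002) 91–110; arXiv:math/0008134 — §4 Theorem 4.3,
  Corollary 4.4 with proof, Corollary 4.5, Theorem 4.7 with proof (held text `paper:arxiv-math_0008134`,
  p0010–p0011); §2 Lemma 2.6, Example 2.3 (p0004).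
* [DolgachevZarhin2024] I. Dolgachev, Yu. G. Zarhin, *Endomorphisms of Complex Abelian Varieties* (2024),
  §2.3 Theorem 2.21, Step 3–4 (the tree's `natCard_algEquiv_matrix_mul`, `isVerySimple_of_commutator_eq_top'`).
-/

namespace Literature.RepresentationTheory

open Module Literature.NumberTheory.GaloisRepresentations

/-! ## §1 `#GL_c(𝔽_q) ≤ (q^c − 1)^c`, strictly for `c ≥ 2`; `#PGL_c(𝔽_q) < ((q^c − 1)^c)/(q − 1)` -/

section Cardinalities

variable {k : Type*} [Field k] [Fintype k]

/-- "the order of `GL_a(𝔽_p)` does not exceed `((p^{[√N]} − 1)^{[√N]})`", first step: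
`#GL_c(𝔽_q) = ∏_{i<c} (q^c − q^i) ≤ (q^c − 1)^c`. [cite: Zarhin2002CyclicCovers, §4 Corollary 4.4 (proof, case (iii))] -/
theorem natCard_GL_le (c : ℕ) : Nat.card (GL (Fin c) k) ≤ (Fintype.card k ^ c - 1) ^ c := by
  rw [Matrix.card_GL_field]
  calc ∏ i : Fin c, (Fintype.card k ^ c - Fintype.card k ^ (i : ℕ))
      ≤ ∏ _i : Fin c, (Fintype.card k ^ c - 1) :=
        Finset.prod_le_prod (fun i _ ↦ Nat.zero_le _) fun i _ ↦
          Nat.sub_le_sub_left (Nat.one_le_pow _ _ Fintype.card_pos) _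
    _ = (Fintype.card k ^ c - 1) ^ c := by
        rw [Finset.prod_const, Finset.card_univ, Fintype.card_fin]

/-- For `c ≥ 2` the inequality is strict: `#GL_c(𝔽_q) < (q^c − 1)^c` (the factor `q^c − q < q^c − 1`).
This is what makes the printed "Hence, the order of `H` is strictly greater than the order of
`PGL_a(𝔽_p)`" correct. [cite: Zarhin2002CyclicCovers, §4 Corollary 4.4 (proof, case (iii))] -/
theorem natCard_GL_lt {c : ℕ} (hc : 2 ≤ c) : Nat.card (GL (Fin c) k) < (Fintype.card k ^ c - 1) ^ c := by
  have hq : 1 < Fintype.card k := Fintype.one_lt_card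
  rw [Matrix.card_GL_field]
  calc ∏ i : Fin c, (Fintype.card k ^ c - Fintype.card k ^ (i : ℕ))
      < ∏ _i : Fin c, (Fintype.card k ^ c - 1) := by
        refine Finset.prod_lt_prod (fun i _ ↦ Nat.sub_pos_of_lt (Nat.pow_lt_pow_right hq i.2))
          (fun i _ ↦ Nat.sub_le_sub_left (Nat.one_le_pow _ _ Fintype.card_pos) _)
          ⟨⟨1, hc⟩, Finset.mem_univ _, ?_⟩
        exact Nat.sub_lt_sub_left (Nat.one_lt_pow (by omega) hq) (by simpa using hq)
    _ = (Fintype.card k ^ c - 1) ^ c := by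
        rw [Finset.prod_const, Finset.card_univ, Fintype.card_fin]

/-- "therefore the order of `PGL_a(𝔽_p)` does not exceed `((p^{[√N]} − 1)^{[√N]})/(p − 1)`", sharpened:
for `c ≥ 2`, `#PGL_c(𝔽_q) = #GL_c(𝔽_q)/(q − 1) < ((q^c − 1)^c)/(q − 1)` (`q − 1` divides both), with
`PGL_c(𝔽_q)` rendered as `Aut_{𝔽_q-alg}(Mat_c(𝔽_q))` (g10-#1's `natCard_algEquiv_matrix_mul`).
[cite: Zarhin2002CyclicCovers, §4 Corollary 4.4 (proof, case (iii))] -/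
theorem natCard_algEquiv_matrix_lt {c : ℕ} (hc : 2 ≤ c) :
    Nat.card (Matrix (Fin c) (Fin c) k ≃ₐ[k] Matrix (Fin c) (Fin c) k) <
      (Fintype.card k ^ c - 1) ^ c / (Fintype.card k - 1) := by
  have hmul := natCard_algEquiv_matrix_mul (k := k) (c := c) (by omega)
  rw [Nat.card_eq_fintype_card (α := k)] at hmul
  have hdvd : Fintype.card k - 1 ∣ (Fintype.card k ^ c - 1) ^ c :=
    (Nat.sub_one_dvd_pow_sub_one _ _).trans (dvd_pow_self _ (by omega))
  rw [Nat.lt_div_iff_mul_lt' hdvd]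
  calc (Fintype.card k - 1) * Nat.card (Matrix (Fin c) (Fin c) k ≃ₐ[k] Matrix (Fin c) (Fin c) k)
      = Nat.card (GL (Fin c) k) := by rw [mul_comm, hmul]
    _ < (Fintype.card k ^ c - 1) ^ c := natCard_GL_lt hc

/-- Monotonicity of the bound: `((q^c − 1)^c)/(q − 1) ≤ ((q^s − 1)^s)/(q − 1)` for `c ≤ s` (used with
`s = [√N]`, "one of the factors say, `a` does not exceed `[√N]`").
[cite: Zarhin2002CyclicCovers, §4 Corollary 4.4 (proof, case (iii))] -/
theorem pow_sub_one_pow_div_mono {q c s : ℕ} (hq : 1 < q) (hcs : c ≤ s) :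
    (q ^ c - 1) ^ c / (q - 1) ≤ (q ^ s - 1) ^ s / (q - 1) := by
  apply Nat.div_le_div_right
  rcases Nat.eq_zero_or_pos s with rfl | hs
  · obtain rfl : c = 0 := by omega
    exact le_rfl
  calc (q ^ c - 1) ^ c ≤ (q ^ s - 1) ^ c :=
        Nat.pow_le_pow_left (Nat.sub_le_sub_right (Nat.pow_le_pow_right (by omega) hcs) 1) c
    _ ≤ (q ^ s - 1) ^ s :=
        Nat.pow_le_pow_right (Nat.sub_pos_of_lt (Nat.one_lt_pow (by omega) hq)) hcs

/-- "The case (iv) follows readily from the case (iii)": `((q^{[√N]} − 1)^{[√N]})/(q − 1) ≤ (q^N − 1)/(q − 1)`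
for `N ≥ 1` (`(x − 1)^s + 1 ≤ x^s` and `[√N]² ≤ N`).
[cite: Zarhin2002CyclicCovers, §4 Corollary 4.4 (proof, case (iv))] -/
theorem pow_sqrt_sub_one_pow_div_le {q N : ℕ} (hq : 1 < q) (hN : 0 < N) :
    (q ^ Nat.sqrt N - 1) ^ Nat.sqrt N / (q - 1) ≤ (q ^ N - 1) / (q - 1) := by
  apply Nat.div_le_div_right
  have hs : 0 < Nat.sqrt N := Nat.sqrt_pos.2 hN
  have h1 : (q ^ Nat.sqrt N - 1) ^ Nat.sqrt N + 1 ≤ (q ^ Nat.sqrt N) ^ Nat.sqrt N := by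
    have h := pow_add_pow_le (Nat.zero_le (q ^ Nat.sqrt N - 1)) (Nat.zero_le 1) hs.ne'
    rwa [one_pow, Nat.sub_add_cancel (Nat.one_le_pow _ _ (by omega))] at h
  have h2 : (q ^ Nat.sqrt N) ^ Nat.sqrt N ≤ q ^ N := by
    rw [← pow_mul]
    exact Nat.pow_le_pow_right (by omega) (Nat.sqrt_le N)
  omega

end Cardinalities

/-! ## §2 Corollary 4.4 (i), (iii), (iv) -/

section OrderBound

variable {k : Type*} [Field k] {H : Type*} [Group H] {V : Type*} [AddCommGroup V] [Module k V]
  {ρ : Representation k H V}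

/-- "Since `H` is simple, each homomorphism from `H` is either trivial or injective."
[cite: Zarhin2002CyclicCovers, §4 Corollary 4.4 (proof, case (iii))] -/
theorem eq_one_or_injective_of_isSimpleGroup [IsSimpleGroup H] {A : Type*} [Group A] (f : H →* A) :
    f = 1 ∨ Function.Injective f := by
  rcases (inferInstance : f.ker.Normal).eq_bot_or_eq_top with h | h
  · exact Or.inr ((MonoidHom.ker_eq_bot_iff f).1 h)
  · refine Or.inl (MonoidHom.ext fun x ↦ ?_)
    rw [MonoidHom.one_apply]
    exact MonoidHom.mem_ker.1 (h ▸ Subgroup.mem_top x)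

/-- "`H` is not isomorphic to a subgroup of `𝐒_N`" ⇒ no homomorphism `H → 𝐒_N` is injective.
[cite: Zarhin2002CyclicCovers, §4 Corollary 4.4] -/
theorem not_injective_of_forall_isEmpty_mulEquiv {N : ℕ}
    (hS : ∀ S : Subgroup (Equiv.Perm (Fin N)), IsEmpty (H ≃* S)) (f : H →* Equiv.Perm (Fin N)) :
    ¬ Function.Injective f :=
  fun hf ↦ (hS f.range).false (MonoidHom.ofInjective hf)

/-- **Corollary 4.4 (i) (Zarhin 2002), over any finite field.** For `H` simple non-abelian, `V` an
absolutely simple (irreducible with `End_H(V) = 𝔽`) `N`-dimensional `H`-module over a finite field `𝔽`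
such that `H` is not isomorphic to a subgroup of `𝐒_N` (no `H → 𝐒_N` is injective): if `N` is a prime
then `V` is very simple ("either `a` or `b` is `1` and […] `PGL_1(𝔽_p) = {1}`"). Via g10-#2's Theorem 4.3
(`isVerySimple_of_commutator_eq_top'`). [cite: Zarhin2002CyclicCovers, §4 Corollary 4.4 (i)] -/
theorem isVerySimple_of_prime_finrank_of_isSimpleGroup [Finite k] [FiniteDimensional k V]
    [ρ.IsIrreducible] [IsSimpleGroup H] (hna : ¬ IsMulCommutative H)
    (hcomm : Subalgebra.centralizer k (Set.range (ρ : H → Module.End k V)) = ⊥)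
    (hS : ∀ f : H →* Equiv.Perm (Fin (finrank k V)), ¬ Function.Injective f)
    (hp : (finrank k V).Prime) : IsVerySimple ρ := by
  refine isVerySimple_of_commutator_eq_top' hcomm (commutator_eq_top_of_isSimpleGroup hna)
    (fun f ↦ (eq_one_or_injective_of_isSimpleGroup f).resolve_right (hS f)) fun c h1 hdvd hsq f ↦ ?_
  exfalso
  rcases (Nat.dvd_prime hp).1 hdvd with rfl | rfl
  · omega
  · have : finrank k V * finrank k V ≤ finrank k V * 1 := by simpa using hsq
    have := Nat.le_of_mul_le_mul_left this (by omega)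
    omega

/-- **Corollary 4.4 (iii) (Zarhin 2002), over any finite field `𝔽 = 𝔽_q`.** "Let […] `V` a vector space
over `𝔽_p` of finite dimension `N`. Let `H ⊂ Aut(V)` be a non-abelian simple group. Suppose that the
`H`-module `V` is absolutely simple and `H` is not isomorphic to a subgroup of `𝐒_N`. Then the `H`-module
`V` is very simple if […] (iii) `#(H) ≥ ((p^{[√N]} − 1)^{[√N]})/(p − 1)`."  Proof as printed: for a
factorisation `N = ab` with `1 < a ≤ b` one has `a ≤ [√N]`, `#PGL_a(𝔽_q) < ((q^{[√N]} − 1)^{[√N]})/(q − 1)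
≤ #H`, so no `H → PGL_a(𝔽_q)` is injective, hence all are trivial (`H` simple); Theorem 4.3
(`isVerySimple_of_commutator_eq_top'`, `PGL_c = Aut_{𝔽-alg}(Mat_c 𝔽)`) concludes. Here `H` is any simple
non-abelian group acting (not necessarily faithfully), `[√N] = Nat.sqrt N`, absolutely simple =
irreducible with `End_H(V) = 𝔽`. [cite: Zarhin2002CyclicCovers, §4 Corollary 4.4 (iii)] -/
theorem isVerySimple_of_pow_sqrt_le_card [Fintype k] [FiniteDimensional k V] [ρ.IsIrreducible]
    [IsSimpleGroup H] (hna : ¬ IsMulCommutative H)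
    (hcomm : Subalgebra.centralizer k (Set.range (ρ : H → Module.End k V)) = ⊥)
    (hS : ∀ f : H →* Equiv.Perm (Fin (finrank k V)), ¬ Function.Injective f)
    (hcard : (Fintype.card k ^ Nat.sqrt (finrank k V) - 1) ^ Nat.sqrt (finrank k V) /
      (Fintype.card k - 1) ≤ Nat.card H) :
    IsVerySimple ρ := by
  refine isVerySimple_of_commutator_eq_top' hcomm (commutator_eq_top_of_isSimpleGroup hna)
    (fun f ↦ (eq_one_or_injective_of_isSimpleGroup f).resolve_right (hS f)) fun c h1 _ hsq f ↦ ?_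
  rcases eq_one_or_injective_of_isSimpleGroup f with h | h
  · exact h
  · exfalso
    haveI : Finite (Matrix (Fin c) (Fin c) k ≃ₐ[k] Matrix (Fin c) (Fin c) k) :=
      Finite.of_injective (fun e ↦ (e : Matrix (Fin c) (Fin c) k → Matrix (Fin c) (Fin c) k))
        DFunLike.coe_injective
    have hle : Nat.card H ≤ Nat.card (Matrix (Fin c) (Fin c) k ≃ₐ[k] Matrix (Fin c) (Fin c) k) :=
      Nat.card_le_card_of_injective f h
    have hlt := natCard_algEquiv_matrix_lt (k := k) (c := c) h1
    have hmono := pow_sub_one_pow_div_mono (q := Fintype.card k) Fintype.one_lt_card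
      (Nat.le_sqrt.2 hsq)
    omega

/-- **Corollary 4.4 (iv) (Zarhin 2002), over any finite field `𝔽 = 𝔽_q`**: "(iv) `#(H) ≥ (p^N − 1)/(p − 1)`"
⇒ `V` is very simple ("The case (iv) follows readily from the case (iii)").
[cite: Zarhin2002CyclicCovers, §4 Corollary 4.4 (iv)] -/
theorem isVerySimple_of_pow_finrank_le_card [Fintype k] [FiniteDimensional k V] [ρ.IsIrreducible]
    [IsSimpleGroup H] (hna : ¬ IsMulCommutative H)
    (hcomm : Subalgebra.centralizer k (Set.range (ρ : H → Module.End k V)) = ⊥)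
    (hS : ∀ f : H →* Equiv.Perm (Fin (finrank k V)), ¬ Function.Injective f)
    (hcard : (Fintype.card k ^ finrank k V - 1) / (Fintype.card k - 1) ≤ Nat.card H) :
    IsVerySimple ρ := by
  have hN : 0 < finrank k V := by
    have hne : (⊥ : Subrepresentation ρ) ≠ ⊤ := bot_ne_top
    have hne' : (⊥ : Submodule k V) ≠ ⊤ := fun e ↦ hne (Subrepresentation.toSubmodule_injective e)
    haveI : Nontrivial V := (Submodule.nontrivial_iff k).mp (nontrivial_of_ne _ _ hne')
    exact Module.finrank_pos
  exact isVerySimple_of_pow_sqrt_le_card hna hcomm hS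
    ((pow_sqrt_sub_one_pow_div_le Fintype.one_lt_card hN).trans hcard)

/-- **Corollary 4.4 (iii) verbatim** (`𝔽 = 𝔽_p`, "`H` is not isomorphic to a subgroup of `𝐒_N`" as
stated). [cite: Zarhin2002CyclicCovers, §4 Corollary 4.4 (iii)] -/
theorem zarhin2002_corollary_4_4_iii {p : ℕ} [Fact p.Prime] {V : Type*} [AddCommGroup V]
    [Module (ZMod p) V] [FiniteDimensional (ZMod p) V] {ρ : Representation (ZMod p) H V}
    [ρ.IsIrreducible] [IsSimpleGroup H] (hna : ¬ IsMulCommutative H)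
    (hcomm : Subalgebra.centralizer (ZMod p) (Set.range (ρ : H → Module.End (ZMod p) V)) = ⊥)
    (hS : ∀ S : Subgroup (Equiv.Perm (Fin (finrank (ZMod p) V))), IsEmpty (H ≃* S))
    (hcard : (p ^ Nat.sqrt (finrank (ZMod p) V) - 1) ^ Nat.sqrt (finrank (ZMod p) V) / (p - 1) ≤
      Nat.card H) :
    IsVerySimple ρ :=
  isVerySimple_of_pow_sqrt_le_card hna hcomm (not_injective_of_forall_isEmpty_mulEquiv hS)
    (by rwa [ZMod.card])

/-- **Corollary 4.4 (iv) verbatim** (`𝔽 = 𝔽_p`). [cite: Zarhin2002CyclicCovers, §4 Corollary 4.4 (iv)] -/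
theorem zarhin2002_corollary_4_4_iv {p : ℕ} [Fact p.Prime] {V : Type*} [AddCommGroup V]
    [Module (ZMod p) V] [FiniteDimensional (ZMod p) V] {ρ : Representation (ZMod p) H V}
    [ρ.IsIrreducible] [IsSimpleGroup H] (hna : ¬ IsMulCommutative H)
    (hcomm : Subalgebra.centralizer (ZMod p) (Set.range (ρ : H → Module.End (ZMod p) V)) = ⊥)
    (hS : ∀ S : Subgroup (Equiv.Perm (Fin (finrank (ZMod p) V))), IsEmpty (H ≃* S))
    (hcard : (p ^ finrank (ZMod p) V - 1) / (p - 1) ≤ Nat.card H) :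
    IsVerySimple ρ :=
  isVerySimple_of_pow_finrank_le_card hna hcomm (not_injective_of_forall_isEmpty_mulEquiv hS)
    (by rwa [ZMod.card])

/-- **Corollary 4.4 (i) verbatim** (`𝔽 = 𝔽_p`, `N` a prime). [cite: Zarhin2002CyclicCovers, §4 Corollary 4.4 (i)] -/
theorem zarhin2002_corollary_4_4_i {p : ℕ} [Fact p.Prime] {V : Type*} [AddCommGroup V]
    [Module (ZMod p) V] [FiniteDimensional (ZMod p) V] {ρ : Representation (ZMod p) H V}
    [ρ.IsIrreducible] [IsSimpleGroup H] (hna : ¬ IsMulCommutative H)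
    (hcomm : Subalgebra.centralizer (ZMod p) (Set.range (ρ : H → Module.End (ZMod p) V)) = ⊥)
    (hS : ∀ S : Subgroup (Equiv.Perm (Fin (finrank (ZMod p) V))), IsEmpty (H ≃* S))
    (hp : (finrank (ZMod p) V).Prime) : IsVerySimple ρ :=
  isVerySimple_of_prime_finrank_of_isSimpleGroup hna hcomm (not_injective_of_forall_isEmpty_mulEquiv hS)
    hp

/-- **Corollary 4.5 (Zarhin 2002) verbatim.** "Suppose `n ≥ 5` is an integer, `B` is an `n`-element set.
Suppose `p = 3`. Then the `Alt(B)`-module `(𝔽_3^B)^{00}` is very simple." (The tree's proof, Q1315's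
`isVerySimple_heart_alternatingGroup_zmod_three`, goes through the heart/augmentation machinery rather
than Corollary 4.4 (iv).) [cite: Zarhin2002CyclicCovers, §4 Corollary 4.5] -/
theorem zarhin2002_corollary_4_5 {X : Type*} [Fintype X] [DecidableEq X] (h5 : 5 ≤ Fintype.card X) :
    IsVerySimple (heart (ZMod 3) (alternatingGroup X) X) :=
  isVerySimple_heart_alternatingGroup_zmod_three h5

end OrderBound

/-! ## §3 Theorem 4.7 [ZarhinCrelle] at `n = p = 5` via Corollary 4.4 (i) -/

section FiveFive

variable (k : Type*) [Field k] {X : Type*} [Fintype X] [DecidableEq X] {G : Type*} [Group G]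
  [MulAction G X]

/-- **Theorem 4.7 (Zarhin 2002) at `n = p = 5`** ("Assume now that `n = p`. Then either `n = p = 5` or
`n = p = 7`. In both cases `N = dim_{𝔽_p}((𝔽_p^B)^{00}) = n − 2` is a prime. Now the very simplicity of
`(𝔽_p^B)^{00}` follows from Corollary 4.4 (i)."), for every finite field `k` of characteristic `5` and
`#B = 5`: the `Alt(B)`-module `(k^B)^{00}` is very simple — `N = 3` is prime, `Alt(B) ≅ 𝐀_5` is simple
with `3! < 60 = #Alt(B)`, and the module is absolutely simple (Lemma 2.6 at `(5, 5)`, g12-#1's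
`heart_isIrreducible_of_card_eq_five` / `centralizer_heart_eq_bot_of_card_eq_five`); the prime case of
Theorem 4.3 (g10-#1's `isVerySimple_of_prime_finrank`) concludes. (The case `n = p = 7` is g11-#3's
`isVerySimple_heart_alternatingGroup_zmod_of_prime`.) [cite: Zarhin2002CyclicCovers, §4 Theorem 4.7 (proof, case `n = p`)]
[cite: Zarhin2002CyclicCovers, §4 Corollary 4.4 (i)] -/
theorem isVerySimple_heart_alternatingGroup_of_card_eq_five_of_cast_eq_zero [Finite k]
    (h5 : Fintype.card X = 5) (hn : (Fintype.card X : k) = 0) :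
    IsVerySimple (heart k (alternatingGroup X) X) := by
  have hcard : 5 ≤ Nat.card X := by rw [Nat.card_eq_fintype_card]; omega
  haveI : IsSimpleGroup (alternatingGroup X) := alternatingGroup.isSimpleGroup hcard
  haveI : Nonempty X := Fintype.card_pos_iff.1 (by omega)
  have hA : alternatingGroup X ≤ (MulAction.toPermHom (alternatingGroup X) X).range :=
    fun σ hσ ↦ ⟨⟨σ, hσ⟩, Equiv.ext fun _ ↦ rfl⟩
  haveI := heart_isIrreducible_of_card_eq_five k (G := alternatingGroup X) h5 hn hA
  have hN : finrank k (augmentationSubmodule k X ⧸ heartKer k X) = 3 := by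
    rw [finrank_heart_of_eq_zero k X hn, h5]
  exact isVerySimple_of_prime_finrank (centralizer_heart_eq_bot_of_card_eq_five k h5 hn hA)
    (factorial_finrank_heart_lt_card_alternatingGroup k (by omega)) (hN ▸ Nat.prime_three)

/-- The same for every `G` whose image in `Perm(B)` contains `Alt(B)` (Remark 4.2 (ii)).
[cite: Zarhin2002CyclicCovers, §4 Theorem 4.7 (proof, case `n = p`)] [cite: Zarhin2002CyclicCovers, §4 Remark 4.2 (ii)] -/
theorem isVerySimple_heart_of_card_eq_five_of_cast_eq_zero [Finite k] (h5 : Fintype.card X = 5)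
    (hn : (Fintype.card X : k) = 0) (hA : alternatingGroup X ≤ (MulAction.toPermHom G X).range) :
    IsVerySimple (heart k G X) :=
  (isVerySimple_heart_alternatingGroup_of_card_eq_five_of_cast_eq_zero k h5 hn).of_range_subset
    (range_heart_alternatingGroup_subset k hA)

/-- **Theorem 4.7 (Zarhin 2002) verbatim at `n = p = 5`**: for `#B = 5` (and the prime `p = 5`) the
`Alt(B)`-module `(𝔽_p^B)^{00}` is very simple. [cite: Zarhin2002CyclicCovers, §4 Theorem 4.7] -/
theorem isVerySimple_heart_alternatingGroup_zmod_of_card_eq_five {p : ℕ} [Fact p.Prime] (hp : p = 5)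
    (h5 : Fintype.card X = 5) : IsVerySimple (heart (ZMod p) (alternatingGroup X) X) :=
  isVerySimple_heart_alternatingGroup_of_card_eq_five_of_cast_eq_zero (ZMod p) h5
    ((CharP.cast_eq_zero_iff (ZMod p) p _).2 (by rw [hp, h5]))

end FiveFive

end Literature.RepresentationTheory
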